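import Summits.NavierStokesRegularity.NavierStokesRegularity.Theorems.ExtremiserTransienceNearExtremalTransienceExtremiserLiouvilleConstantSpeedSlideTranslation
import HarnessLib

/-!
# Crux `ExtremiserTransience.NearExtremalTransience` (stmt-NavierStokesRegularity-21883), line `extremiser_liouville`,
# stub K1b — TRANSLATION TOOLKIT, part 2: vertical sliding AVERAGES converge in `L²` (blueprint L4, tools)

`--supports stmt-NavierStokesRegularity-21883` (helper).  Author: prover seat `ns-el-k1b` (g8).  Sequel of `…SlideTranslation`.
The third kind of term in `h⁻¹φ̂_h` (discrete slide direction, `…SlideQuotient`) is a vertical sliding average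
`A_hK(x) = h⁻¹∫_{−h}^{0} K(x + te₂)dt` of an `L²` quantity `K` built from `V, DV, D²V` (e.g. `K = ∇(g′V₂)`):
* `norm_verticalAverage_sub_sq_le` : `‖A_hK(x) − K(x)‖² ≤ h⁻¹∫_{−h}^{0}‖K(x + te₂) − K(x)‖²dt` (`K` continuous, `h > 0`);
* `lintegral_verticalAverage_sub_le` : `∫‖A_hK − K‖² ≤ h⁻¹∫_{t∈(−h,0]}∫‖K(· + te₂) − K‖²dt` (Tonelli);
* `tendsto_lintegral_verticalAverage_sub` : **`∫‖A_hK − K‖² → 0` as `h → 0⁺`** for continuous `K ∈ L²`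
  (translation continuity, `exists_delta_lintegral_translate_axis_le`).

WHAT THIS IS NOT: K1b is NOT proved; nothing here proves NS regularity. [folklore]
-/

noncomputable section

open Set Filter Topology MeasureTheory Metric Function InnerProductSpace
open scoped ENNReal NNReal Topology InnerProductSpace RealInnerProductSpace ContDiff
open Literature.Analysis.FluidPDE Literature.Analysis

namespace Summit.NavierStokesRegularity.NavierStokesRegularity.Theorems

-- the problem directory repeats the summit name (`NavierStokesRegularity/NavierStokesRegularity`)
set_option linter.dupNamespace false

namespace ExtremiserLiouville

open DepletionLadder.KStar

variable {F' : Type*} [NormedAddCommGroup F'] [NormedSpace ℝ F'] [CompleteSpace F']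

/-- **Pointwise step**: `‖h⁻¹∫_{−h}^{0}K(x + te₂)dt − K(x)‖² ≤ h⁻¹∫_{−h}^{0}‖K(x + te₂) − K(x)‖²dt` (`K` continuous, `h > 0`).
[folklore] -/
theorem norm_verticalAverage_sub_sq_le {K : EuclideanSpace ℝ (Fin 3) → F'} (hK : Continuous K) {h : ℝ} (hh : 0 < h)
    (x : EuclideanSpace ℝ (Fin 3)) :
    ‖h⁻¹ • (∫ t in (-h)..0, K (x + t • EuclideanSpace.single (2 : Fin 3) (1 : ℝ))) - K x‖ ^ 2 ≤
      h⁻¹ * ∫ t in (-h)..0, ‖K (x + t • EuclideanSpace.single (2 : Fin 3) (1 : ℝ)) - K x‖ ^ 2 := by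
  set e₂ : EuclideanSpace ℝ (Fin 3) := EuclideanSpace.single (2 : Fin 3) (1 : ℝ) with he₂
  set c' : ℝ → F' := fun t => K (x + t • e₂) with hc'
  have hc'c : Continuous c' := hK.comp (continuous_const.add (continuous_id.smul continuous_const))
  have hconst : ∫ _t in (-h)..0, K x = h • K x := by
    rw [intervalIntegral.integral_const]; simp
  have hdiff : h⁻¹ • (∫ t in (-h)..0, c' t) - K x = h⁻¹ • ∫ t in (-h)..0, (c' t - K x) := by
    rw [intervalIntegral.integral_sub (hc'c.intervalIntegrable _ _) intervalIntegrable_const, hconst]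
    conv_rhs => rw [smul_sub, smul_smul, inv_mul_cancel₀ hh.ne', one_smul]
  rw [hdiff, norm_smul, mul_pow, Real.norm_eq_abs, abs_of_pos (inv_pos.2 hh)]
  have hφ : Continuous fun t => ‖c' t - K x‖ := (hc'c.sub continuous_const).norm
  have hcs := Literature.Geometry.Riemannian.sq_intervalIntegral_le_length_mul_of_continuous hφ (neg_nonpos.2 hh.le)
  simp only [sub_neg_eq_add, zero_add] at hcs
  have hn : ‖∫ t in (-h)..0, (c' t - K x)‖ ≤ ∫ t in (-h)..0, ‖c' t - K x‖ :=
    intervalIntegral.norm_integral_le_integral_norm (neg_nonpos.2 hh.le)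
  calc h⁻¹ ^ 2 * ‖∫ t in (-h)..0, (c' t - K x)‖ ^ 2
      ≤ h⁻¹ ^ 2 * (∫ t in (-h)..0, ‖c' t - K x‖) ^ 2 := by gcongr
    _ ≤ h⁻¹ ^ 2 * (h * ∫ t in (-h)..0, ‖c' t - K x‖ ^ 2) := mul_le_mul_of_nonneg_left hcs (sq_nonneg _)
    _ = h⁻¹ * ∫ t in (-h)..0, ‖c' t - K x‖ ^ 2 := by field_simp

/-- **`L²` bound for the sliding average**: `∫‖A_hK − K‖² ≤ h⁻¹∫_{t∈(−h,0]}∫‖K(· + te₂) − K‖²dt` (Tonelli). [folklore] -/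
theorem lintegral_verticalAverage_sub_le {K : EuclideanSpace ℝ (Fin 3) → F'} (hK : Continuous K) {h : ℝ} (hh : 0 < h) :
    ∫⁻ x, ‖h⁻¹ • (∫ t in (-h)..0, K (x + t • EuclideanSpace.single (2 : Fin 3) (1 : ℝ))) - K x‖ₑ ^ 2 ≤
      ENNReal.ofReal h⁻¹ * ∫⁻ t in Ioc (-h) 0, ∫⁻ x,
        ‖K (x + t • EuclideanSpace.single (2 : Fin 3) (1 : ℝ)) - K x‖ₑ ^ 2 := by
  set e₂ : EuclideanSpace ℝ (Fin 3) := EuclideanSpace.single (2 : Fin 3) (1 : ℝ) with he₂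
  have cD : Continuous fun p : EuclideanSpace ℝ (Fin 3) × ℝ => K (p.1 + p.2 • e₂) - K p.1 :=
    (hK.comp (continuous_fst.add (continuous_snd.smul continuous_const))).sub (hK.comp continuous_fst)
  set Φ : EuclideanSpace ℝ (Fin 3) → ℝ → ℝ≥0∞ := fun x t => ‖K (x + t • e₂) - K x‖ₑ ^ 2 with hΦ
  have hΦm : AEMeasurable (uncurry Φ) ((volume : Measure (EuclideanSpace ℝ (Fin 3))).prod
      ((volume : Measure ℝ).restrict (Ioc (-h) 0))) :=
    ((ENNReal.continuous_pow 2).comp cD.enorm).measurable.aemeasurable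
  have hstep : ∀ x, ‖h⁻¹ • (∫ t in (-h)..0, K (x + t • e₂)) - K x‖ₑ ^ 2 ≤
      ENNReal.ofReal h⁻¹ * ∫⁻ t in Ioc (-h) 0, Φ x t := by
    intro x
    have hc : Continuous fun t : ℝ => ‖K (x + t • e₂) - K x‖ ^ 2 := ((cD.comp (Continuous.prodMk_right x)).norm.pow 2)
    have hi : IntegrableOn (fun t : ℝ => ‖K (x + t • e₂) - K x‖ ^ 2) (Ioc (-h) 0) volume :=
      (hc.integrableOn_Icc (a := -h) (b := 0)).mono_set Ioc_subset_Icc_self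
    rw [← ofReal_norm, ← ENNReal.ofReal_pow (norm_nonneg _)]
    calc ENNReal.ofReal (‖h⁻¹ • (∫ t in (-h)..0, K (x + t • e₂)) - K x‖ ^ 2)
        ≤ ENNReal.ofReal (h⁻¹ * ∫ t in (-h)..0, ‖K (x + t • e₂) - K x‖ ^ 2) :=
          ENNReal.ofReal_le_ofReal (norm_verticalAverage_sub_sq_le hK hh x)
      _ = ENNReal.ofReal h⁻¹ * ∫⁻ t in Ioc (-h) 0, Φ x t := by
          rw [ENNReal.ofReal_mul (inv_nonneg.2 hh.le), intervalIntegral.integral_of_le (neg_nonpos.2 hh.le),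
            ofReal_integral_eq_lintegral_ofReal hi (Eventually.of_forall fun t => sq_nonneg _)]
          congr 1
          refine setLIntegral_congr_fun measurableSet_Ioc fun t _ => ?_
          simp only [hΦ]
          rw [ENNReal.ofReal_pow (norm_nonneg _), ofReal_norm]
  calc ∫⁻ x, ‖h⁻¹ • (∫ t in (-h)..0, K (x + t • e₂)) - K x‖ₑ ^ 2
      ≤ ∫⁻ x, ENNReal.ofReal h⁻¹ * ∫⁻ t in Ioc (-h) 0, Φ x t := lintegral_mono hstep
    _ = ENNReal.ofReal h⁻¹ * ∫⁻ x, ∫⁻ t in Ioc (-h) 0, Φ x t := by rw [lintegral_const_mul' _ _ ENNReal.ofReal_ne_top]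
    _ = ENNReal.ofReal h⁻¹ * ∫⁻ t in Ioc (-h) 0, ∫⁻ x, Φ x t := by rw [lintegral_lintegral_swap hΦm]

omit [CompleteSpace F'] in
/-- **Vertical sliding averages converge in `L²`**: for continuous `K ∈ L²(ℝ³)`,
`∫‖h⁻¹∫_{−h}^{0}K(· + te₂)dt − K‖² → 0` as `h → 0⁺`. [folklore] -/
theorem tendsto_lintegral_verticalAverage_sub [CompleteSpace F'] {K : EuclideanSpace ℝ (Fin 3) → F'} (hK : Continuous K)
    (hK2 : MemLp K 2 (volume : Measure (EuclideanSpace ℝ (Fin 3)))) :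
    Tendsto (fun h : ℝ => ∫⁻ x, ‖h⁻¹ • (∫ t in (-h)..0, K (x + t • EuclideanSpace.single (2 : Fin 3) (1 : ℝ))) - K x‖ₑ ^ 2)
      (𝓝[>] 0) (𝓝 0) := by
  set e₂ : EuclideanSpace ℝ (Fin 3) := EuclideanSpace.single (2 : Fin 3) (1 : ℝ) with he₂
  refine ENNReal.tendsto_nhds_zero.2 fun ε hε => ?_
  obtain ⟨δ, hδ, hsmall⟩ := exists_delta_lintegral_translate_axis_le hK2 hε
  have hev : ∀ᶠ h : ℝ in 𝓝[>] 0, 0 < h ∧ h < δ := by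
    have h1 : ∀ᶠ h : ℝ in 𝓝[>] 0, h < δ := mem_nhdsWithin_of_mem_nhds (Iio_mem_nhds hδ)
    exact (eventually_mem_nhdsWithin.and h1).mono fun h hh => ⟨hh.1, hh.2⟩
  refine hev.mono fun h hh => ?_
  obtain ⟨hpos, hlt⟩ := hh
  refine (lintegral_verticalAverage_sub_le hK hpos).trans ?_
  have hbound : ∀ t ∈ Ioc (-h) 0, ∫⁻ x, ‖K (x + t • e₂) - K x‖ₑ ^ 2 ≤ ε := fun t ht =>
    hsmall t (abs_lt.2 ⟨by linarith [ht.1], by linarith [ht.2]⟩)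
  calc ENNReal.ofReal h⁻¹ * ∫⁻ t in Ioc (-h) 0, ∫⁻ x, ‖K (x + t • e₂) - K x‖ₑ ^ 2
      ≤ ENNReal.ofReal h⁻¹ * ∫⁻ _t in Ioc (-h) 0, ε := mul_le_mul_right (setLIntegral_mono measurable_const hbound) _
    _ = ENNReal.ofReal h⁻¹ * (ε * ENNReal.ofReal h) := by
        rw [setLIntegral_const, Real.volume_Ioc, sub_neg_eq_add, zero_add, mul_comm ε]
    _ = ε := by
        rw [mul_comm ε, ← mul_assoc, ← ENNReal.ofReal_mul (inv_nonneg.2 hpos.le), inv_mul_cancel₀ hpos.ne',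
          ENNReal.ofReal_one, one_mul]

end ExtremiserLiouville

end Summit.NavierStokesRegularity.NavierStokesRegularity.Theorems

end
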